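import Mathlib
import Summits.CriticalPhenomena.CardyFormulaZ2.Theorems.CardyMagicRigidityDefs
import Summits.CriticalPhenomena.CardyFormulaZ2.Theorems.CardyMagicRigidityNestingRigidityTransferGluing
import Literature.Probability.RandomPlanarGeometry.LoopConfigurationsMetric
import HarnessLib

/-!
# Stub `treeRigidityTame_of_tameRigidity`, step (4): gluing two limits at coupling distance `0`

Crux `Summit.CriticalPhenomena.CardyFormulaZ2.Theses.CardyMagicRigidity.NestingRigidity`
(stmt-CriticalPhenomena-4835), line `positive-cone-weight-doubling`, registered helper
`treeRigidityTame_of_tameRigidity : (tame rigidity) → TreeRigidityTame` (vocabulary of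
`Theorems/CardyMagicRigidityPositiveConeJointDefs.lean`, p130599).  Its last step is pure measure theory
on DKKMO's coupling distance `d_CN` of laws (`LoopConfig.cnLawEDist`): if bond-`ℤ²` at meshes `δₖ`
converges to a presentation `X` on `([0,1], Leb)`, site-`𝕋` converges to a presentation `X'`, and the two
presentations are at coupling distance `0`, then `d_CN(bond_{δₖ}, site_{δₖ}) → 0`.  This file proves it,
sorry-free, for the concrete ensembles `zEns` / `tEns`:

* §1 `cnLawEDist_eq_zero_of_coupling` — a coupling of the two laws under which the configurations are
  `ε`-close for EVERY `ε > 0` almost surely witnesses `d_CN = 0` (`cnLawEDist_le_of_coupling`; the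
  exceptional event sits inside a null set, no measurability needed: `d_CN` of laws measures it by the
  outer measure).  This is how step (3) of the stub (reconstruction along a coupling of the typed count
  statistics) delivers `d_CN(X, X') = 0`.
* §2 `cnLawEDist_tEns_le_add` — `d_CN(site_δ, X) ≤ d_CN(site_δ, X') + d_CN(X', X)`: the triangle
  inequality `LoopConfig.cnLawEDist_triangle` with OUTER pair (site_δ, X) — standard Borel outer spaces
  (`standardBorelSpace_siteConfig`, `unitInterval`) and the measurable outer exceptional event, which is
  exactly the measurability hypothesis carried by `TreeRigidityTame` / `TamePrecompact`.
* §3 `tendsto_cnLawEDist_zEns_tEns_of_limits` (registered anchor) — the assembled step (4):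
  `d_CN(bond_k, site_k) ≤ d_CN(bond_k, X) + d_CN(site_k, X)` (`cnLawEDist_bond_site_le_add`, p72412: outer
  pair (bond, site), `measurableSet_isClose_bond_site`) `≤ d_CN(bond_k, X) + d_CN(site_k, X') + d_CN(X', X)`,
  and the last term vanishes; squeeze in `ℝ≥0∞`.
-/

noncomputable section

open MeasureTheory Set Filter Metric
open scoped Real Topology BigOperators ENNReal

namespace Summit.CriticalPhenomena.CardyFormulaZ2.Cruxes.NestingRigidity.PositiveConeWeightDoubling

open Literature.Probability.RandomPlanarGeometry Literature.Probability.Percolation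
  Literature.Probability.LatticeModels
open Summit.CriticalPhenomena.CardyFormulaZ2.Cruxes.NestingRigidity.RingCloudTomography

/-! ## §1 Coupling distance `0` from an almost surely close coupling -/

/-- **An a.s.-close coupling witnesses `d_CN = 0`.**  If `P` couples `μ` and `μ'` and, for `P`-a.e.
pair, the two configurations satisfy `d_CN ≤ ε` (printed sense, `LoopConfig.IsClose`) for EVERY `ε > 0`,
then DKKMO's coupling distance of the two laws vanishes.  (No measurability of the exceptional events is
needed: each lies inside the `P`-null set where the a.s. statement fails.) -/
theorem cnLawEDist_eq_zero_of_coupling {E Ω Ω' : Type*} [NormedAddCommGroup E] [MeasurableSpace Ω]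
    [MeasurableSpace Ω'] {μ : Measure Ω} {μ' : Measure Ω'} {X : Ω → LoopConfig E}
    {X' : Ω' → LoopConfig E} (P : Measure (Ω × Ω')) (h₁ : P.map Prod.fst = μ)
    (h₂ : P.map Prod.snd = μ') (h : ∀ᵐ p ∂P, ∀ ε : ℝ, 0 < ε → LoopConfig.IsClose ε (X p.1) (X' p.2)) :
    LoopConfig.cnLawEDist μ X μ' X' = 0 := by
  refine le_antisymm (ENNReal.le_of_forall_pos_le_add fun ε hε _ ↦ ?_) bot_le
  rw [zero_add, ← ENNReal.ofReal_coe_nnreal]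
  have hε' : (0 : ℝ) < ε := by exact_mod_cast hε
  refine LoopConfig.cnLawEDist_le_of_coupling hε' P h₁ h₂ ?_
  have h0 : P {p | ¬ LoopConfig.IsClose (ε : ℝ) (X p.1) (X' p.2)} = 0 := by
    rw [ae_iff] at h
    refine measure_mono_null (fun p hp ↦ ?_) h
    exact fun hall ↦ hp (hall _ hε')
  rw [h0]
  exact ENNReal.ofReal_pos.2 hε'

/-- Symmetric form: the same coupling also witnesses `d_CN((μ', X'), (μ, X)) = 0`. -/
theorem cnLawEDist_eq_zero_of_coupling' {E Ω Ω' : Type*} [NormedAddCommGroup E] [MeasurableSpace Ω]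
    [MeasurableSpace Ω'] {μ : Measure Ω} {μ' : Measure Ω'} {X : Ω → LoopConfig E}
    {X' : Ω' → LoopConfig E} (P : Measure (Ω × Ω')) (h₁ : P.map Prod.fst = μ)
    (h₂ : P.map Prod.snd = μ') (h : ∀ᵐ p ∂P, ∀ ε : ℝ, 0 < ε → LoopConfig.IsClose ε (X p.1) (X' p.2)) :
    LoopConfig.cnLawEDist μ' X' μ X = 0 := by
  rw [LoopConfig.cnLawEDist_comm]
  exact cnLawEDist_eq_zero_of_coupling P h₁ h₂ h

/-! ## §2 The triangle inequality through the second limit -/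

/-- **`d_CN(site_δ, X) ≤ d_CN(site_δ, X') + d_CN(X', X)`** for two presentations `X`, `X'` on
`([0,1], Leb)`, as soon as the OUTER exceptional events `{(ω, s) | d_CN(site_δ(ω), X s) ≤ ε}` are
measurable (`LoopConfig.cnLawEDist_triangle`: the outer spaces `SiteConfig (Site 2)` and `[0,1]` are
standard Borel). -/
theorem cnLawEDist_tEns_le_add (δ : ℝ) (X X' : unitInterval → LoopConfig ℂ)
    (hm : ∀ ε : ℝ, MeasurableSet {p : tEns.Ω × unitInterval |
      LoopConfig.IsClose ε (tEns.X δ p.1) (X p.2)}) :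
    LoopConfig.cnLawEDist tEns.P (tEns.X δ) volume X ≤
      LoopConfig.cnLawEDist tEns.P (tEns.X δ) volume X' + LoopConfig.cnLawEDist volume X' volume X := by
  haveI : IsProbabilityMeasure tEns.P := inferInstanceAs (IsProbabilityMeasure (triSitePercolation half))
  haveI : StandardBorelSpace tEns.Ω := standardBorelSpace_siteConfig
  haveI : Nonempty tEns.Ω := inferInstanceAs (Nonempty (SiteConfig (Site 2)))
  exact LoopConfig.cnLawEDist_triangle tEns.P volume volume (tEns.X δ) X' X hm

/-- **`d_CN(bond_δ, site_δ') ≤ d_CN(bond_δ, X) + d_CN(site_δ', X)`** for every presentation `X` on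
`([0,1], Leb)` (`cnLawEDist_bond_site_le_add`, p72412, read for the ensembles `zEns` / `tEns`). -/
theorem cnLawEDist_zEns_tEns_le_add (δ δ' : ℝ) (X : unitInterval → LoopConfig ℂ) :
    LoopConfig.cnLawEDist zEns.P (zEns.X δ) tEns.P (tEns.X δ') ≤
      LoopConfig.cnLawEDist zEns.P (zEns.X δ) volume X + LoopConfig.cnLawEDist tEns.P (tEns.X δ') volume X :=
  cnLawEDist_bond_site_le_add volume X δ δ'

/-! ## §3 Step (4) assembled (registered anchor) -/

/-- **Gluing two limits at coupling distance `0` (step (4) of `treeRigidityTame_of_tameRigidity`;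
registered anchor).**  If along the mesh sequence `δs` bond-`ℤ²` converges in DKKMO's coupling distance to
a presentation `X` on `([0,1], Leb)` and site-`𝕋` to a presentation `X'`, the outer exceptional events of
the pair (site, `X`) are measurable, and `d_CN((Leb, X), (Leb, X')) = 0`, then
`d_CN(bond_{δs k}, site_{δs k}) → 0`:
`d_CN(bond_k, site_k) ≤ d_CN(bond_k, X) + d_CN(site_k, X') + d_CN(X', X)` (§2 twice) and squeeze. -/
theorem tendsto_cnLawEDist_zEns_tEns_of_limits : ∀ (δs : ℕ → ℝ) (X X' : unitInterval → LoopConfig ℂ),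
    Tendsto (fun k : ℕ ↦ LoopConfig.cnLawEDist zEns.P (zEns.X (δs k)) volume X) atTop (𝓝 0) →
    Tendsto (fun k : ℕ ↦ LoopConfig.cnLawEDist tEns.P (tEns.X (δs k)) volume X') atTop (𝓝 0) →
    (∀ (ε : ℝ) (k : ℕ), MeasurableSet {p : tEns.Ω × unitInterval |
      LoopConfig.IsClose ε (tEns.X (δs k) p.1) (X p.2)}) →
    LoopConfig.cnLawEDist volume X volume X' = 0 →
    Tendsto (fun k : ℕ ↦ LoopConfig.cnLawEDist zEns.P (zEns.X (δs k)) tEns.P (tEns.X (δs k)))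
      atTop (𝓝 0) := by
  intro δs X X' hZ hT hm h0
  have h0' : LoopConfig.cnLawEDist volume X' volume X = 0 := by rwa [LoopConfig.cnLawEDist_comm]
  have hle : ∀ k, LoopConfig.cnLawEDist zEns.P (zEns.X (δs k)) tEns.P (tEns.X (δs k)) ≤
      LoopConfig.cnLawEDist zEns.P (zEns.X (δs k)) volume X +
        LoopConfig.cnLawEDist tEns.P (tEns.X (δs k)) volume X' := fun k ↦
    calc LoopConfig.cnLawEDist zEns.P (zEns.X (δs k)) tEns.P (tEns.X (δs k))
        ≤ LoopConfig.cnLawEDist zEns.P (zEns.X (δs k)) volume X +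
            LoopConfig.cnLawEDist tEns.P (tEns.X (δs k)) volume X :=
          cnLawEDist_zEns_tEns_le_add _ _ X
      _ ≤ LoopConfig.cnLawEDist zEns.P (zEns.X (δs k)) volume X +
            (LoopConfig.cnLawEDist tEns.P (tEns.X (δs k)) volume X' +
              LoopConfig.cnLawEDist volume X' volume X) := by
          gcongr
          exact cnLawEDist_tEns_le_add _ X X' (fun ε ↦ hm ε k)
      _ = _ := by rw [h0', add_zero]
  refine tendsto_of_tendsto_of_tendsto_of_le_of_le tendsto_const_nhds ?_ (fun _ ↦ bot_le) hle
  simpa using hZ.add hT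

end Summit.CriticalPhenomena.CardyFormulaZ2.Cruxes.NestingRigidity.PositiveConeWeightDoubling

end
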